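import Summits.NavierStokesRegularity.NavierStokesRegularity.Theorems.RobustBlowupPortabilityDivFreeTruncationAveraged
import Summits.NavierStokesRegularity.NavierStokesRegularity.Theorems.RobustBlowupPortabilityDivFreeTruncationCollar
import Summits.NavierStokesRegularity.NavierStokesRegularity.Theorems.RobustBlowupPortabilityDivFreeTruncationBumps
import Summits.NavierStokesRegularity.NavierStokesRegularity.Theses.RobustBlowupPortability
import HarnessLib

/-!
# Divergence-free truncation with collar control
  (closes item stmt-NavierStokesRegularity-2928, `RobustBlowupPortability.DivFreeTruncation`)

**Theorem** (`robustBlowupPortability_divFreeTruncation_proof`). For `ρ > 0` and bounds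
`A : ℕ → ℝ`, `E : ℝ` there is `C : ℕ → ℝ` such that every smooth divergence-free `V` on `ℝ³` with
`∫_{B(x₀,2ρ)} ‖V‖² ≤ E` and `‖DʲV‖ ≤ A j` on the shell `ρ/2 ≤ |x − x₀| ≤ 2ρ` admits a smooth
divergence-free `u₀` with `u₀ = V` on `|x − x₀| ≤ ρ`, `u₀ = 0` on `|x − x₀| ≥ 2ρ` and
`‖Dʲu₀(x)‖ ≤ C j` for `|x − x₀| ≥ ρ` — the constants depending on `(ρ, A, E)` only.

**Construction** (an averaged Poincaré homotopy in place of Bogovskiĭ's operator, Galdi §III.3):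
`u₀ = ∫ θ(a) Ψ_χ[V(· + a)](x − a) da`, the average over centres `‖a‖ ≤ ρ/16` (normed bump `θ`) of
the translated solenoidal truncations with a cut-off `χ` (`= 1` on `‖y‖ < 9ρ/8`, `= 0` on
`‖y‖ ≥ 15ρ/8`) corrected by the Poincaré homotopy field (`…Cutoff`, `…Averaged`): smooth,
divergence free, `= V` on `‖x‖ ≤ ρ`, `= 0` on `‖x‖ > 31ρ/16`. The collar bounds: `u₀ = (θ ⋆ χ) V + 𝒢`
with the corrector `𝒢` a double parametric integral of `V` along the segments `[a, x]`; splitting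
the ray parameter at `t = 5/8`, the far part sees `V` only on the shell (bounds `A`), and the near
part becomes — after the substitution `b = (1 − t)a + tx`, which moves every derivative onto the
`V`-free kernel — an integral operator with smooth kernel applied to `V` on `‖b‖ ≤ 3ρ/2`, bounded by
`∫_{B(0,2ρ)} ‖V‖ ≤ |B| + E` (`…Kernel`, `…Subst`, `…Collar`; all-orders differentiation under the
integral sign `…Parametric`). This is where the energy bound enters. Translation by `x₀` at the end.

HONEST FRAMING: a vector-calculus truncation lemma about arbitrary smooth divergence-free fields;
nothing here bears on Navier–Stokes regularity.

## References
* M. E. Bogovskiĭ, Dokl. Akad. Nauk SSSR 248 (1979); G. P. Galdi, *An Introduction to the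
  Mathematical Theory of the Navier–Stokes Equations*, 2nd ed. (2011), §III.3.
* H. Jia, V. Šverák, Invent. Math. 196 (2014), footnote to Thm. 3.1 (use of such truncations).
* M. Costabel, A. McIntosh, Math. Z. 265 (2010) (regularized Poincaré / Bogovskiĭ operators).
-/

noncomputable section

set_option linter.dupNamespace false

namespace Summit.NavierStokesRegularity.NavierStokesRegularity.Theorems

open Set MeasureTheory Filter Topology Function ContinuousLinearMap Module Metric
open scoped ContDiff
open Literature.Analysis.FluidPDE

namespace DivFreeTruncation

/-- **Divergence-free truncation with collar control, centred at the origin.** [folklore] -/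
theorem divFreeTruncation_centred {ρ : ℝ} (hρ : 0 < ρ) (A : ℕ → ℝ) (E0 : ℝ) :
    ∃ C : ℕ → ℝ, ∀ V : EuclideanSpace ℝ (Fin 3) → EuclideanSpace ℝ (Fin 3), ContDiff ℝ ∞ V →
      VectorCalculus.IsDivFree V →
      (∫ x in ball (0 : EuclideanSpace ℝ (Fin 3)) (2 * ρ), ‖V x‖ ^ 2) ≤ E0 →
      (∀ (j : ℕ) (x : EuclideanSpace ℝ (Fin 3)), ρ / 2 ≤ ‖x‖ → ‖x‖ ≤ 2 * ρ →
        ‖iteratedFDeriv ℝ j V x‖ ≤ A j) →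
      ∃ u₀ : EuclideanSpace ℝ (Fin 3) → EuclideanSpace ℝ (Fin 3), ContDiff ℝ ∞ u₀ ∧
        VectorCalculus.IsDivFree u₀ ∧ (∀ x, ‖x‖ ≤ ρ → u₀ x = V x) ∧
        (∀ x, 2 * ρ ≤ ‖x‖ → u₀ x = 0) ∧
        ∀ (j : ℕ) (x : EuclideanSpace ℝ (Fin 3)), ρ ≤ ‖x‖ → ‖iteratedFDeriv ℝ j u₀ x‖ ≤ C j := by
  obtain ⟨θ, hθ, hθ0, hθ1⟩ := exists_weight hρ
  obtain ⟨χ, hχ, hχ1, hχ0⟩ := exists_cutoff hρ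
  -- the `V`-free corrector kernel
  obtain ⟨K, hK_def⟩ : ∃ K : EuclideanSpace ℝ (Fin 3) → EuclideanSpace ℝ (Fin 3) → ℝ →
      (EuclideanSpace ℝ (Fin 3) →L[ℝ] EuclideanSpace ℝ (Fin 3)),
      K = fun x a t => (θ a * t) • ((fderiv ℝ χ (x - a) (x - a)) •
          ContinuousLinearMap.id ℝ (EuclideanSpace ℝ (Fin 3)) -
        (fderiv ℝ χ (x - a)).smulRight (x - a)) := ⟨_, rfl⟩
  have hK : ContDiff ℝ ∞ fun q : EuclideanSpace ℝ (Fin 3) × (EuclideanSpace ℝ (Fin 3) × ℝ) =>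
      K q.1 q.2.1 q.2.2 := by
    rw [hK_def]
    exact contDiff_correctorKernel hθ hχ
  have hK0 : ∀ x a t, ρ / 16 < ‖a‖ → K x a t = 0 := fun x a t ha => by
    rw [hK_def]
    ext v
    simp [hθ0 a ha.le]
  -- the `V`-free scalar factor `θ ⋆ χ`
  obtain ⟨c, hc_def⟩ : ∃ c : EuclideanSpace ℝ (Fin 3) → ℝ,
      c = fun x => ∫ a in closedBall (0 : EuclideanSpace ℝ (Fin 3)) (ρ / 16), θ a * χ (x - a) :=
    ⟨_, rfl⟩
  have hc : ContDiff ℝ ∞ c := by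
    rw [hc_def]
    exact contDiff_setIntegral_of_contDiff (f := fun x a => θ a * χ (x - a))
      ((hθ.comp contDiff_snd).mul (hχ.comp (contDiff_fst.sub contDiff_snd)))
      (isCompact_closedBall _ _) volume
  have hKx : IsCompact (closedBall (0 : EuclideanSpace ℝ (Fin 3)) (2 * ρ)) :=
    isCompact_closedBall _ _
  -- constants
  choose M hM0 hM using fun n => corrector_collar_estimate hK hρ hK0 n
  choose N hN0 hN using fun n => exists_forall_norm_iteratedFDeriv_le_of_compact hc hKx n
  refine ⟨fun n => 2 ^ n * N n * (∑ j ∈ Finset.range (n + 1), |A j|) +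
    M n * (max ((volume : Measure (EuclideanSpace ℝ (Fin 3))).real
      (ball (0 : EuclideanSpace ℝ (Fin 3)) (2 * ρ)) + E0) 0 + ∑ j ∈ Finset.range (n + 1), |A j|), ?_⟩
  intro V hV hdiv hE hA
  -- the averaged truncation
  obtain ⟨T, hT⟩ : ∃ T : EuclideanSpace ℝ (Fin 3) → EuclideanSpace ℝ (Fin 3) →
      EuclideanSpace ℝ (Fin 3), T = fun x a => χ (x - a) • V x +
      (fderiv ℝ χ (x - a) (x - a)) • poincareField (fun z => V (z + a)) (x - a) -
      (fderiv ℝ χ (x - a) (poincareField (fun z => V (z + a)) (x - a))) • (x - a) := ⟨_, rfl⟩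
  obtain ⟨u, hu⟩ : ∃ u : EuclideanSpace ℝ (Fin 3) → EuclideanSpace ℝ (Fin 3),
      u = fun x => ∫ a in closedBall (0 : EuclideanSpace ℝ (Fin 3)) (ρ / 16), θ a • T x a :=
    ⟨_, rfl⟩
  have hR₁ : ρ + ρ / 16 < 9 * ρ / 8 := by linarith
  refine ⟨u, contDiff_averagedTruncation hθ hχ hV hT hu,
    isDivFree_averagedTruncation hθ hχ hV hdiv hT hu,
    fun x hx => averagedTruncation_eq_self hT hu hχ1 hR₁ hθ1 hx,
    fun x hx => averagedTruncation_eq_zero hT hu hχ0 (by linarith), fun n x hx => ?_⟩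
  show ‖iteratedFDeriv ℝ n u x‖ ≤ 2 ^ n * N n * (∑ j ∈ Finset.range (n + 1), |A j|) +
    M n * (max ((volume : Measure (EuclideanSpace ℝ (Fin 3))).real
      (ball (0 : EuclideanSpace ℝ (Fin 3)) (2 * ρ)) + E0) 0 + ∑ j ∈ Finset.range (n + 1), |A j|)
  have hAbar0 : 0 ≤ ∑ j ∈ Finset.range (n + 1), |A j| :=
    Finset.sum_nonneg fun j _ => abs_nonneg (A j)
  by_cases hx2 : ‖x‖ < 2 * ρ
  · -- inside the collar: `u = c V + corrector`
    have hdec : u = fun y => c y • V y +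
        ∫ a in closedBall (0 : EuclideanSpace ℝ (Fin 3)) (ρ / 16), ∫ t in (0 : ℝ)..1,
          K y a t (V (t • (y - a) + a)) := by
      funext y
      rw [hc_def, hK_def]
      exact averagedTruncation_eq_smul_add_corrector hθ hχ hV hT hu y
    have hcV : ContDiff ℝ ∞ fun y => c y • V y := hc.smul hV
    have hG : ContDiff ℝ ∞ fun y => ∫ a in closedBall (0 : EuclideanSpace ℝ (Fin 3)) (ρ / 16),
        ∫ t in (0 : ℝ)..1, K y a t (V (t • (y - a) + a)) := contDiff_corrector hK hV (ρ / 16)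
    rw [hdec, fun_iteratedFDeriv_add_apply (hcV.contDiffAt.of_le (by exact_mod_cast le_top))
      (hG.contDiffAt.of_le (by exact_mod_cast le_top))]
    refine (norm_add_le _ _).trans ?_
    have h1 : ‖iteratedFDeriv ℝ n (fun y => c y • V y) x‖ ≤
        2 ^ n * N n * ∑ j ∈ Finset.range (n + 1), |A j| :=
      norm_iteratedFDeriv_smul_le_of_bounds hc hV hA (hN0 n)
        (fun i hi => hN n i hi x (mem_closedBall_zero_iff.2 hx2.le)) (by linarith) hx2.le
    have h2 := hM n V hV A hA x (by linarith) hx2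
    have h3 : ∫ y in ball (0 : EuclideanSpace ℝ (Fin 3)) (2 * ρ), ‖V y‖ ≤
        max ((volume : Measure (EuclideanSpace ℝ (Fin 3))).real
          (ball (0 : EuclideanSpace ℝ (Fin 3)) (2 * ρ)) + E0) 0 :=
      (setIntegral_norm_le hV.continuous (2 * ρ)).trans ((add_le_add le_rfl hE).trans
        (le_max_left _ _))
    refine (add_le_add h1 h2).trans ?_
    exact add_le_add le_rfl (mul_le_mul_of_nonneg_left (add_le_add h3 le_rfl) (hM0 n))
  · -- outside: `u` vanishes identically near `x`
    have hx2' : 15 * ρ / 8 + ρ / 16 < ‖x‖ := by linarith [not_lt.1 hx2]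
    rw [iteratedFDeriv_averagedTruncation_eq_zero hT hu hχ0 hx2' n, norm_zero]
    have := hN0 n
    have := hM0 n
    positivity

end DivFreeTruncation

open DivFreeTruncation in
/-- **Divergence-free truncation with collar control** (item stmt-NavierStokesRegularity-2928,
route `RobustBlowupPortability`, support #9): for `ρ > 0` and bounds `A`, `E` there is
`C : ℕ → ℝ` such that every smooth divergence-free `V` on `ℝ³` with `∫_{B(x₀,2ρ)} |V|² ≤ E` and
`|DʲV| ≤ A j` on the shell `ρ/2 ≤ |x − x₀| ≤ 2ρ` admits a smooth divergence-free `u₀` with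
`u₀ = V` on `B̄(x₀, ρ)`, `u₀ = 0` off `B(x₀, 2ρ)`, and `|Dʲu₀| ≤ C j` for `|x − x₀| ≥ ρ`
(averaged Poincaré-homotopy truncation; Galdi 2011 §III.3, Jia–Šverák 2014 fn. to Thm 3.1).
[folklore] -/
theorem robustBlowupPortability_divFreeTruncation_proof :
    Summit.NavierStokesRegularity.NavierStokesRegularity.Theses.RobustBlowupPortability.DivFreeTruncation := by
  unfold Summit.NavierStokesRegularity.NavierStokesRegularity.Theses.RobustBlowupPortability.DivFreeTruncation
  intro ρ hρ A E0
  obtain ⟨C, hC⟩ := divFreeTruncation_centred hρ A E0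
  refine ⟨C, fun x₀ V hV hdiv hE hA => ?_⟩
  -- translate to the origin
  obtain ⟨W, hW⟩ : ∃ W : EuclideanSpace ℝ (Fin 3) → EuclideanSpace ℝ (Fin 3),
      W = fun z => V (z + x₀) := ⟨_, rfl⟩
  have hWs : ContDiff ℝ ∞ W := by rw [hW]; exact hV.comp (contDiff_id.add contDiff_const)
  have hWdiv : VectorCalculus.IsDivFree W := fun x => by
    rw [hW, divergence_comp_add]; exact hdiv _
  have hWE : (∫ x in ball (0 : EuclideanSpace ℝ (Fin 3)) (2 * ρ), ‖W x‖ ^ 2) ≤ E0 := by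
    rw [hW]
    exact (setIntegral_ball_comp_add (fun y => ‖V y‖ ^ 2) x₀ (2 * ρ)).trans_le hE
  have hWA : ∀ (j : ℕ) (x : EuclideanSpace ℝ (Fin 3)), ρ / 2 ≤ ‖x‖ → ‖x‖ ≤ 2 * ρ →
      ‖iteratedFDeriv ℝ j W x‖ ≤ A j := by
    intro j x h1 h2
    rw [hW, iteratedFDeriv_comp_add_right]
    have hd : dist (x + x₀) x₀ = ‖x‖ := by rw [dist_eq_norm, add_sub_cancel_right]
    exact hA j (x + x₀) (by rwa [hd]) (by rwa [hd])
  obtain ⟨u, hu1, hu2, hu3, hu4, hu5⟩ := hC W hWs hWdiv hWE hWA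
  refine ⟨fun x => u (x - x₀), hu1.comp (contDiff_id.sub contDiff_const), fun x => ?_,
    fun x hx => ?_, fun x hx => ?_, fun j x hx => ?_⟩
  · rw [divergence_comp_sub]; exact hu2 _
  · rw [dist_eq_norm] at hx
    show u (x - x₀) = V x
    rw [hu3 _ hx, hW]
    simp
  · rw [dist_eq_norm] at hx
    exact hu4 _ hx
  · rw [dist_eq_norm] at hx
    rw [iteratedFDeriv_comp_sub]
    exact hu5 j _ hx

end Summit.NavierStokesRegularity.NavierStokesRegularity.Theorems
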